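import Mathlib.Algebra.Ring.BooleanRing
import Summits.QuantumAdvantage.QuantumAdvantage.Theorems.CubicForrelationSignedExactCubicForrelationNotPrBPPStubPolarGeometry
import Literature.Computability.QuantumComplexity.QuadraticFourierSamplerProofs

/-!
# No-trap theorem (template coordinates) — helper lemmas, part 1

Helper file for stub `stub_noTrapTemplate` of line `dual-pingpong-frame`, crux stmt-QuantumAdvantage-13932
(`SignedExactCubicForrelationNotPrBPP`, route `QuantumAdvantage/CubicForrelation`). No definitions; the second
difference `D_u D_v f (x) = f x ⊕ f (x ⊕ u) ⊕ f (x ⊕ v) ⊕ f (x ⊕ u ⊕ v)` enters every lemma as a function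
parameter `D` together with its defining equation `hD`, and inner products are spelled
`(univ.filter fun i => uᵢ ∧ zᵢ).card.bodd` as in the registered stub.

* Bookkeeping: unit vectors `e_{castAdd i} = (eᵢ, 0)`, `e_{natAdd i} = (0, eᵢ)`; `eᵢ·z = zᵢ`;
  `(g, 0)·u = g·u'`, `(0, r)·u = r·u''`.
* Calculus of second differences: symmetry, the cocycle law
  `D_{u ⊕ u'} D_v f (x) = D_u D_v f (x ⊕ u') ⊕ D_{u'} D_v f (x)`, and for `f` of algebraic degree `≤ 3`
  (`IsDegLeFun 3`, bridged to the tree's derivative calculus `CHHL2018.lowDeg` by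
  `QuadPolar.toZFun_mem_lowDeg_of_poly`): third differences do not depend on the base point
  (`D3_basefree`), are additive in the outer slot, and are therefore represented by the row vector
  `k ↦ D_{e_k} D_u D_v f (0)` (`D3_repr`, via `QuadSampler.additive_eq_sum`).
* Subspace counting on `𝔽₂ⁿ` (finsets containing `0` closed under `⊕`): `W^⊥⊥ = W` (`perp_perp_eq`, from
  `DerivativeWalsh.card_mul_card_perp`) and `|A| = |φ(A)| · |A ∩ ker φ|` for an additive `φ`
  (`card_eq_card_image_mul_card_ker`, fibres are translates of the kernel).

References: C. Carlet, *Boolean Functions for Cryptography and Coding Theory*, CUP 2020, §2.2.2 (derivatives lower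
the degree) [Carlet2020]; R. O'Donnell, *Analysis of Boolean Functions*, CUP 2014, §3.3 [ODonnell2014].
-/

noncomputable section

set_option linter.dupNamespace false -- D-0017: single-problem summit ⇒ `QuantumAdvantage.QuantumAdvantage` by design

namespace Summit.QuantumAdvantage.QuantumAdvantage.Theorems.SignedExactCubicForrelationNotPrBPP

open Finset
open Literature.Computability.Complexity Literature.Computability.QuantumComplexity
open Literature.Computability.QuantumComplexity.BuzetChailloux (bxor zeroVec bxor_self bxor_comm
  bxor_zeroVec zeroVec_bxor)
open Literature.Computability.Complexity.BLR (toZ toZ_xor toZ_and toZ_injective)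
open PolarGeometry (toZ_bdot bdot_comm bdot_bxor_left bdot_bxor_right twist_eq_one_iff_bdot)

namespace NoTrap

variable {m n : ℕ}

/-! ### Unit vectors, frames and inner products -/

/-- The unit vector at a left position is `(eᵢ, 0)`. [folklore] -/
theorem unitVec_castAdd (i : Fin m) :
    (fun j : Fin (m + m) => decide (j = Fin.castAdd m i)) =
      Fin.append (fun j : Fin m => decide (j = i)) (zeroVec : Fin m → Bool) := by
  funext j
  refine Fin.addCases (fun k => ?_) (fun k => ?_) j
  · rw [Fin.append_left]
    by_cases hk : k = i
    · subst hk; simp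
    · simp [hk]
  · rw [Fin.append_right]
    have hne : Fin.natAdd m k ≠ Fin.castAdd m i := fun h => by
      have := congrArg Fin.val h
      simp only [Fin.val_natAdd, Fin.val_castAdd] at this
      omega
    exact decide_eq_false hne

/-- The unit vector at a right position is `(0, eᵢ)`. [folklore] -/
theorem unitVec_natAdd (i : Fin m) :
    (fun j : Fin (m + m) => decide (j = Fin.natAdd m i)) =
      Fin.append (zeroVec : Fin m → Bool) (fun j : Fin m => decide (j = i)) := by
  funext j
  refine Fin.addCases (fun k => ?_) (fun k => ?_) j
  · rw [Fin.append_left]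
    have hne : Fin.castAdd m k ≠ Fin.natAdd m i := fun h => by
      have := congrArg Fin.val h
      simp only [Fin.val_natAdd, Fin.val_castAdd] at this
      omega
    exact decide_eq_false hne
  · rw [Fin.append_right]
    by_cases hk : k = i
    · subst hk; simp
    · simp [hk]

/-- `eᵢ · z = zᵢ`. [folklore] -/
theorem bdot_unit (i : Fin m) (z : Fin m → Bool) :
    (univ.filter fun j => (fun j : Fin m => decide (j = i)) j && z j).card.bodd = z i := by
  apply toZ_injective
  rw [toZ_bdot, Finset.sum_eq_single i]
  · simp
  · intro j _ hj
    simp [hj, BLR.toZ]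
  · intro h; exact absurd (mem_univ i) h

/-- `g · 0 = 0`. [folklore] -/
theorem bdot_zeroVec (g : Fin m → Bool) :
    (univ.filter fun i => g i && (zeroVec : Fin m → Bool) i).card.bodd = false := by
  have : (univ.filter fun i => g i && (zeroVec : Fin m → Bool) i) = ∅ :=
    filter_eq_empty_iff.2 fun i _ => by simp [zeroVec]
  rw [this, card_empty, Nat.bodd_zero]

/-- `(g, 0) · u = g · u'` (`u'` = the left half of `u`). [folklore] -/
theorem bdot_append_zeroVec (g : Fin m → Bool) (u : Fin (m + m) → Bool) :
    (univ.filter fun i => Fin.append g (zeroVec : Fin m → Bool) i && u i).card.bodd =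
      (univ.filter fun i => g i && u (Fin.castAdd m i)).card.bodd := by
  apply toZ_injective
  rw [toZ_bdot, toZ_bdot, Fin.sum_univ_add]
  have h2 : ∑ i : Fin m, toZ (Fin.append g (zeroVec : Fin m → Bool) (Fin.natAdd m i) &&
      u (Fin.natAdd m i)) = 0 :=
    Finset.sum_eq_zero fun i _ => by rw [Fin.append_right]; rfl
  rw [h2, add_zero]
  exact Finset.sum_congr rfl fun i _ => by rw [Fin.append_left]

/-- `(0, r) · u = r · u''` (`u''` = the right half of `u`). [folklore] -/
theorem bdot_zeroVec_append (r : Fin m → Bool) (u : Fin (m + m) → Bool) :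
    (univ.filter fun i => Fin.append (zeroVec : Fin m → Bool) r i && u i).card.bodd =
      (univ.filter fun i => r i && u (Fin.natAdd m i)).card.bodd := by
  apply toZ_injective
  rw [toZ_bdot, toZ_bdot, Fin.sum_univ_add]
  have h1 : ∑ i : Fin m, toZ (Fin.append (zeroVec : Fin m → Bool) r (Fin.castAdd m i) &&
      u (Fin.castAdd m i)) = 0 :=
    Finset.sum_eq_zero fun i _ => by rw [Fin.append_left]; rfl
  rw [h1, zero_add]
  exact Finset.sum_congr rfl fun i _ => by rw [Fin.append_right]

/-- `(0, 0) = 0`. [folklore] -/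
theorem append_zeroVec_zeroVec :
    Fin.append (zeroVec : Fin m → Bool) (zeroVec : Fin m → Bool) = (zeroVec : Fin (m + m) → Bool) := by
  funext j
  refine Fin.addCases (fun k => ?_) (fun k => ?_) j
  · rw [Fin.append_left]; rfl
  · rw [Fin.append_right]; rfl

/-- A vector with vanishing right half is `(x', 0)`. [folklore] -/
theorem eq_append_of_right_eq_zeroVec (x : Fin (m + m) → Bool)
    (h : (fun j => x (Fin.natAdd m j)) = (zeroVec : Fin m → Bool)) :
    x = Fin.append (fun i => x (Fin.castAdd m i)) (zeroVec : Fin m → Bool) := by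
  rw [← h]; exact (Fin.append_castAdd_natAdd).symm

/-! ### Second differences: symmetry and the cocycle law (no degree hypothesis) -/

/-- `D_u D_v f = D_v D_u f`. [folklore] -/
theorem D_symm {f : (Fin n → Bool) → Bool}
    (D : (Fin n → Bool) → (Fin n → Bool) → (Fin n → Bool) → Bool)
    (hD : ∀ u v x, D u v x = (f x ^^ f (bxor x u) ^^ f (bxor x v) ^^ f (bxor x (bxor u v))))
    (u v x : Fin n → Bool) : D u v x = D v u x := by
  rw [hD, hD]
  have e : f (bxor x (bxor v u)) = f (bxor x (bxor u v)) := by rw [bxor_comm v u]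
  rw [e]
  generalize f x = A; generalize f (bxor x u) = B; generalize f (bxor x v) = C
  generalize f (bxor x (bxor u v)) = E
  revert A B C E; decide

/-- The cocycle law `D_{u ⊕ u'} D_v f (x) = D_u D_v f (x ⊕ u') ⊕ D_{u'} D_v f (x)`. [folklore] -/
theorem D_bxor_left {f : (Fin n → Bool) → Bool}
    (D : (Fin n → Bool) → (Fin n → Bool) → (Fin n → Bool) → Bool)
    (hD : ∀ u v x, D u v x = (f x ^^ f (bxor x u) ^^ f (bxor x v) ^^ f (bxor x (bxor u v))))
    (u u' v x : Fin n → Bool) : D (bxor u u') v x = (D u v (bxor x u') ^^ D u' v x) := by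
  rw [hD, hD, hD]
  have e1 : f (bxor x (bxor u u')) = f (bxor (bxor x u') u) :=
    congrArg f (by show x + (u + u') = (x + u') + u; abel)
  have e2 : f (bxor x (bxor (bxor u u') v)) = f (bxor (bxor x u') (bxor u v)) :=
    congrArg f (by show x + ((u + u') + v) = (x + u') + (u + v); abel)
  have e3 : f (bxor (bxor x u') v) = f (bxor x (bxor u' v)) :=
    congrArg f (by show (x + u') + v = x + (u' + v); abel)
  rw [e1, e2, e3]
  generalize f x = A; generalize f (bxor (bxor x u') u) = B; generalize f (bxor x v) = C
  generalize f (bxor (bxor x u') (bxor u v)) = E; generalize f (bxor x u') = G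
  generalize f (bxor x (bxor u' v)) = H
  revert A B C E G H; decide

/-- `D_s D_r f (0)` is the offset value `f r ⊕ f (r ⊕ s) ⊕ f 0 ⊕ f s` of the stub. [folklore] -/
theorem D_zeroVec_eq {f : (Fin n → Bool) → Bool}
    (D : (Fin n → Bool) → (Fin n → Bool) → (Fin n → Bool) → Bool)
    (hD : ∀ u v x, D u v x = (f x ^^ f (bxor x u) ^^ f (bxor x v) ^^ f (bxor x (bxor u v))))
    (s r : Fin n → Bool) : D s r zeroVec = (f r ^^ f (bxor r s) ^^ f zeroVec ^^ f s) := by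
  rw [hD, zeroVec_bxor, zeroVec_bxor, zeroVec_bxor]
  have e : f (bxor s r) = f (bxor r s) := by rw [bxor_comm s r]
  rw [e]
  generalize f zeroVec = A; generalize f s = B; generalize f r = C; generalize f (bxor r s) = E
  revert A B C E; decide

/-- The third difference at `0` is symmetric in its last two slots:
`D_y D_s D_r f (0) = D_r D_s D_y f (0)`. [folklore] -/
theorem D3_swap {f : (Fin n → Bool) → Bool}
    (D : (Fin n → Bool) → (Fin n → Bool) → (Fin n → Bool) → Bool)
    (hD : ∀ u v x, D u v x = (f x ^^ f (bxor x u) ^^ f (bxor x v) ^^ f (bxor x (bxor u v))))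
    (s r y : Fin n → Bool) : (D s r zeroVec ^^ D s r y) = (D s y zeroVec ^^ D s y r) := by
  simp only [hD, zeroVec_bxor]
  have e1 : f (bxor y s) = f (bxor s y) := by rw [bxor_comm y s]
  have e2 : f (bxor y r) = f (bxor r y) := by rw [bxor_comm y r]
  have e3 : f (bxor y (bxor s r)) = f (bxor r (bxor s y)) :=
    congrArg f (by show y + (s + r) = r + (s + y); abel)
  have e4 : f (bxor s r) = f (bxor r s) := by rw [bxor_comm s r]
  rw [e1, e2, e3, e4]
  generalize f zeroVec = A; generalize f s = B; generalize f r = C; generalize f (bxor r s) = E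
  generalize f y = G; generalize f (bxor s y) = H; generalize f (bxor r y) = I
  generalize f (bxor r (bxor s y)) = J
  revert A B C E G H I J; decide

/-! ### Third differences of a cubic function -/

/-- Reading `D_u D_v f (z)` in `𝔽₂` as the tree's `der u (der v [f]) (z)`. [folklore] -/
theorem der_der_eq_toZ {f : (Fin n → Bool) → Bool}
    (D : (Fin n → Bool) → (Fin n → Bool) → (Fin n → Bool) → Bool)
    (hD : ∀ u v x, D u v x = (f x ^^ f (bxor x u) ^^ f (bxor x v) ^^ f (bxor x (bxor u v))))
    (u v z : Fin n → Bool) :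
    CHHL2018.der u (CHHL2018.der v (QuadPolar.toZFun f)) z = toZ (D u v z) := by
  have e : f (bxor (bxor z u) v) = f (bxor z (bxor u v)) :=
    congrArg f (by show (z + u) + v = z + (u + v); abel)
  rw [hD, toZ_xor, toZ_xor, toZ_xor]
  show toZ (f (bxor (bxor z u) v)) + toZ (f (bxor z u)) + (toZ (f (bxor z v)) + toZ (f z)) = _
  rw [e]; ring

/-- **Third differences of a cubic do not depend on the base point**:
`D_w D_u D_v f (x) = D_w D_u D_v f (0)` for `f` of algebraic degree `≤ 3` (fourth differences vanish).
[cite: Carlet2020, §2.2.2] -/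
theorem D3_basefree {f : (Fin n → Bool) → Bool} (hf : IsDegLeFun 3 f)
    (D : (Fin n → Bool) → (Fin n → Bool) → (Fin n → Bool) → Bool)
    (hD : ∀ u v x, D u v x = (f x ^^ f (bxor x u) ^^ f (bxor x v) ^^ f (bxor x (bxor u v))))
    (u v w x : Fin n → Bool) : (D u v x ^^ D u v (bxor x w)) = (D u v zeroVec ^^ D u v w) := by
  obtain ⟨p, hp, hfp⟩ := hf
  have h3 : QuadPolar.toZFun f ∈ CHHL2018.lowDeg n 3 := QuadPolar.toZFun_mem_lowDeg_of_poly p hp hfp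
  have h0 : CHHL2018.der w (CHHL2018.der u (CHHL2018.der v (QuadPolar.toZFun f))) ∈ CHHL2018.lowDeg n 0 :=
    CHHL2018.mem_lowDeg_succ.1 (CHHL2018.mem_lowDeg_succ.1 (CHHL2018.mem_lowDeg_succ.1 h3 v) u) w
  have key := CHHL2018.apply_eq_of_mem_lowDeg_zero h0 x zeroVec
  rw [CHHL2018.der_apply w, CHHL2018.der_apply w] at key
  have ex : CHHL2018.der u (CHHL2018.der v (QuadPolar.toZFun f)) (LowDegree.xorVec x w) = toZ (D u v (bxor x w)) :=
    der_der_eq_toZ D hD u v (bxor x w)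
  have e0 : CHHL2018.der u (CHHL2018.der v (QuadPolar.toZFun f)) (LowDegree.xorVec zeroVec w) = toZ (D u v w) := by
    rw [show LowDegree.xorVec zeroVec w = w from zeroVec_bxor w]; exact der_der_eq_toZ D hD u v w
  rw [ex, e0, der_der_eq_toZ D hD, der_der_eq_toZ D hD] at key
  apply toZ_injective
  rw [toZ_xor, toZ_xor]
  linear_combination key

/-- For a cubic `f`, `w ↦ D_w D_u D_v f (0)` is additive. [cite: Carlet2020, §2.2.2] -/
theorem D3_bxor {f : (Fin n → Bool) → Bool} (hf : IsDegLeFun 3 f)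
    (D : (Fin n → Bool) → (Fin n → Bool) → (Fin n → Bool) → Bool)
    (hD : ∀ u v x, D u v x = (f x ^^ f (bxor x u) ^^ f (bxor x v) ^^ f (bxor x (bxor u v))))
    (u v w w' : Fin n → Bool) :
    (D u v zeroVec ^^ D u v (bxor w w')) = ((D u v zeroVec ^^ D u v w) ^^ (D u v zeroVec ^^ D u v w')) := by
  have h := D3_basefree hf D hD u v w' w
  revert h
  generalize D u v zeroVec = A; generalize D u v w = B; generalize D u v w' = C
  generalize D u v (bxor w w') = E
  revert A B C E; decide

/-- **Row representation**: for a cubic `f`, `D_w D_u D_v f (0) = row · w` with the row vector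
`row_k = D_{e_k} D_u D_v f (0)` (an additive functional is the inner product with its values at the unit
vectors, `QuadSampler.additive_eq_sum`). [cite: Carlet2020, §2.2.2] -/
theorem D3_repr {f : (Fin n → Bool) → Bool} (hf : IsDegLeFun 3 f)
    (D : (Fin n → Bool) → (Fin n → Bool) → (Fin n → Bool) → Bool)
    (hD : ∀ u v x, D u v x = (f x ^^ f (bxor x u) ^^ f (bxor x v) ^^ f (bxor x (bxor u v))))
    (u v w : Fin n → Bool) :
    (D u v zeroVec ^^ D u v w) =
      (univ.filter fun i => (fun k => (D u v zeroVec ^^ D u v (fun j => decide (j = k)))) i && w i).card.bodd := by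
  have hadd := QuadSampler.additive_eq_sum (fun w => toZ (D u v zeroVec ^^ D u v w))
    (by show toZ (D u v zeroVec ^^ D u v zeroVec) = 0
        rw [Bool.xor_self]; rfl)
    (fun x y => by rw [← toZ_xor]; exact congrArg toZ (D3_bxor hf D hD u v x y)) w
  apply toZ_injective
  rw [hadd, toZ_bdot]
  refine Finset.sum_congr rfl fun i _ => ?_
  rw [toZ_and, mul_comm]
  rfl

/-! ### Subspace counting in `𝔽₂ⁿ` -/

/-- **`W^⊥⊥ = W`** for a finset `W ∋ 0` closed under `⊕` (from `|W|·|W^⊥| = 2ⁿ = |W^⊥|·|W^⊥⊥|` and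
`W ⊆ W^⊥⊥`). [cite: ODonnell2014, §3.3] -/
theorem perp_perp_eq {W : Finset (Fin n → Bool)} (h0 : zeroVec ∈ W)
    (hadd : ∀ x ∈ W, ∀ y ∈ W, bxor x y ∈ W) :
    univ.filter (fun z => ∀ y ∈ (univ.filter fun y => ∀ x ∈ W, twist x y = 1), twist y z = 1) = W := by
  obtain ⟨hp0, hpadd⟩ := DerivativeWalsh.bxor_mem_perp W
  have h1 := DerivativeWalsh.card_mul_card_perp h0 hadd
  have h2 := DerivativeWalsh.card_mul_card_perp hp0 hpadd
  have hPpos : (0 : ℝ) < (univ.filter fun y => ∀ x ∈ W, twist x y = 1).card := by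
    exact_mod_cast card_pos.2 ⟨_, hp0⟩
  have h3 : ((univ.filter fun y => ∀ x ∈ W, twist x y = 1).card : ℝ) *
      (univ.filter (fun z => ∀ y ∈ (univ.filter fun y => ∀ x ∈ W, twist x y = 1),
        twist y z = 1)).card =
      ((univ.filter fun y => ∀ x ∈ W, twist x y = 1).card : ℝ) * W.card := by
    rw [h2, ← h1, mul_comm]
  have hc : ((univ.filter (fun z => ∀ y ∈ (univ.filter fun y => ∀ x ∈ W, twist x y = 1),
      twist y z = 1)).card : ℝ) = W.card := mul_left_cancel₀ hPpos.ne' h3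
  refine (eq_of_subset_of_card_le (DerivativeWalsh.subset_perp_perp W) ?_).symm
  exact_mod_cast hc.le

/-- **Fibre counting**: for a finset `A ∋ 0` closed under `⊕` and a map `φ` additive on `A`,
`|A| = |φ(A)| · |{x ∈ A : φ x = 0}|` (each fibre is a translate of the kernel). [folklore] -/
theorem card_eq_card_image_mul_card_ker (A : Finset (Fin n → Bool)) (φ : (Fin n → Bool) → (Fin m → Bool))
    (hadd : ∀ x ∈ A, ∀ y ∈ A, bxor x y ∈ A)
    (hφ : ∀ x ∈ A, ∀ y ∈ A, φ (bxor x y) = bxor (φ x) (φ y)) :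
    A.card = (A.image φ).card * (A.filter fun x => φ x = zeroVec).card := by
  rw [card_eq_sum_card_fiberwise (f := φ) (s := A) (t := A.image φ)
    (fun x hx => mem_coe.2 (mem_image_of_mem φ (mem_coe.1 hx))), sum_const_nat]
  intro b hb
  obtain ⟨x₀, hx₀, rfl⟩ := mem_image.1 hb
  refine card_nbij' (fun x => bxor x x₀) (fun x => bxor x x₀) (fun x hx => ?_) (fun x hx => ?_)
    (fun x _ => ?_) (fun x _ => ?_)
  · obtain ⟨hxA, hxφ⟩ := mem_filter.1 (mem_coe.1 hx)
    refine mem_coe.2 (mem_filter.2 ⟨hadd x hxA x₀ hx₀, ?_⟩)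
    rw [hφ x hxA x₀ hx₀, hxφ, bxor_self]
  · obtain ⟨hxA, hxφ⟩ := mem_filter.1 (mem_coe.1 hx)
    refine mem_coe.2 (mem_filter.2 ⟨hadd x hxA x₀ hx₀, ?_⟩)
    rw [hφ x hxA x₀ hx₀, hxφ, zeroVec_bxor]
  · show bxor (bxor x x₀) x₀ = x
    show (x + x₀) + x₀ = x
    rw [add_assoc, show x₀ + x₀ = 0 from bxor_self x₀, add_zero]
  · show bxor (bxor x x₀) x₀ = x
    show (x + x₀) + x₀ = x
    rw [add_assoc, show x₀ + x₀ = 0 from bxor_self x₀, add_zero]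

end NoTrap

/-- **Fibre count** (registered brick `noTrap_fibreCount` of stub `stub_noTrapTemplate`, line `dual-pingpong-frame`,
crux stmt-QuantumAdvantage-13932): for a `⊕`-closed finset `A` of bit vectors and a map `φ` additive on `A`,
`|A| = |φ(A)| · |{x ∈ A : φ x = 0}|` (each fibre is a translate of the kernel). [folklore] -/
theorem noTrap_fibreCount : ∀ {m n : ℕ} (A : Finset (Fin n → Bool)) (φ : (Fin n → Bool) → (Fin m → Bool)), (∀ x ∈ A, ∀ y ∈ A, bxor x y ∈ A) → (∀ x ∈ A, ∀ y ∈ A, φ (bxor x y) = bxor (φ x) (φ y)) → A.card = (A.image φ).card * (A.filter fun x => φ x = zeroVec).card :=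
  fun A φ hadd hφ => NoTrap.card_eq_card_image_mul_card_ker A φ hadd hφ

end Summit.QuantumAdvantage.QuantumAdvantage.Theorems.SignedExactCubicForrelationNotPrBPP

end
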